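import Summits.CriticalPhenomena.PercolationContinuityZ3.Theorems.PercNearOneGluingNoHeavyLowerTailSahiTangentPattern

/-!
# `NoHeavyLowerTail` (crux stmt-CriticalPhenomena-4575), Sahi programme: the tangent pattern inequality in dimension two,
# part 1 — KERNEL BOOKKEEPING: the polarised kernel of `T₃` on `[3]²` as a trilinear form on the 18-point poset `[3]² × [2]`

Support file (Sahi cell, seat `prim-sahi-p1`, generation 48; `--supports stmt-CriticalPhenomena-4575`).  Pure proofs, standard axioms,
no `sorry`; the definitions are bookkeeping only (indices, the lifted kernel, the threshold parametrisation of the up-sets of `[3]²`).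
Part 2 (`…SahiTangentPatternTwoCheck`) runs the finite check and proves `TangentPatternPos 2`.

THE MATHEMATICS.  `TangentPatternPos 2` (`…SahiTangentPattern`) asks `sStarT T B ≥ 0` for all triples of PAIRS `B_i ⊆ T_i` of up-sets of
`[3]² = Fin 2 → Fin 3`, where `sStarT T B = Σ_{π ∈ S₃²} K(col π 0, col π 1, col π 2)` and `K = tker T B` is the polarised (value −
derivative) three-copy kernel of the tangent functional `T₃`.  Two observations organise the check:
* a pair `B ⊆ T` of up-sets of a poset `P` is the same thing as ONE up-set `S = {⊤}×T ∪ {⊥}×B` of `P × [2]` (`pairSet`; here `[2] = Bool`),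
  and every one of the fourteen terms of `K` is a product of exactly one indicator per slot, so `K`, hence `sStarT`, is a TRILINEAR form in
  the three indicator functions `1_{S_0}, 1_{S_1}, 1_{S_2}` on the 18-point set `W2 = Bool × [3]²` (`tker_eq_tkerW`, `tkerW_eq_sum_single`,
  `sStarT_eq_sum_single`): `sStarT T B = Σ_{u ∈ S_0} Σ_{v ∈ S_1} Σ_{w ∈ S_2} C(u,v,w)` with an `18 × 18 × 18` integer coefficient tensor
  `C = sT1` (computed on indices by `CI`, `CI_widx`; outside Lean: 477 non-zero entries, values in `[-2, 8]`, total `0`);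
* the up-sets of `[3]²` are the `20` staircases `U2 v = {q : 3 − v_{q 0} ≤ q 1}` of the nondecreasing threshold vectors `v ∈ {0,…,3}³`
  (`upVecs2`; completeness `U2_vecOf2`, `vecOf2_mem_upVecs2`), and `B ⊆ T` forces `vecOf2 B ≤ vecOf2 T` pointwise (`leV_vecOf2`).
So `TangentPatternPos 2` is the nonnegativity of `175³ = 5 359 375` values of a sparse trilinear form (all `≥ 0`, minimum `0`, `159 439`
zeros, maximum `36`; seat folder `code/tpp2_tensor.py`, and prim-sahi-p1 gen 47 kit j306089 for the unordered count `908 600 / 0`). [this work]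
-/

namespace Summit.CriticalPhenomena.PercolationContinuityZ3.Theorems.SahiTangent

open Finset Literature.Probability.LatticeModels Literature.Combinatorics.Sahi2008
open SahiGrid3 (ind permList permList_nodup mem_permList sum_perm_eq_permList sum_map_flatMap vecs mem_vecs
  mem_iff_card_of_upper)
open SahiGridPattern (Pd col)
open scoped BigOperators

/-! ### The carriers `[3]²` and `Bool × [3]²`, indices -/

/-- The small square `[3]² = Fin 2 → Fin 3` (pointwise order). [this work] -/
abbrev P2 := Pd 2

/-- The 18-point carrier of PAIRS: `(true, q)` is "`q` as a point of the top set", `(false, q)` "of the bottom set". [this work] -/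
abbrev W2 := Bool × P2

/-- Index `3·q₀ + q₁ < 9` of a point of the square. [this work] -/
def pidx (q : P2) : ℕ := 3 * (q 0 : ℕ) + (q 1 : ℕ)

/-- Indices are `< 9`. [this work] -/
theorem pidx_lt (q : P2) : pidx q < 9 := by
  have h0 := (q 0).isLt; have h1 := (q 1).isLt; unfold pidx; omega

/-- The point with a given index. [this work] -/
def pnt (n : ℕ) : P2 := ![⟨n / 3 % 3, Nat.mod_lt _ (by omega)⟩, ⟨n % 3, Nat.mod_lt _ (by omega)⟩]

/-- `pnt ∘ pidx = id`. [this work] -/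
theorem pnt_pidx (q : P2) : pnt (pidx q) = q := by
  have h0 := (q 0).isLt; have h1 := (q 1).isLt
  funext a
  fin_cases a
  · show (pnt (pidx q)) 0 = q 0
    apply Fin.ext; simp only [pnt, pidx, Matrix.cons_val_zero]; omega
  · show (pnt (pidx q)) 1 = q 1
    apply Fin.ext; simp only [pnt, pidx, Matrix.cons_val_one, Matrix.cons_val_zero]; omega

/-- `pidx` is injective. [this work] -/
theorem pidx_injective : Function.Injective pidx := fun q q' h => by
  rw [← pnt_pidx q, ← pnt_pidx q', h]

/-- `pidx ∘ pnt = id` below `9`. [this work] -/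
theorem pidx_pnt {n : ℕ} (hn : n < 9) : pidx (pnt n) = n := by
  simp only [pidx, pnt, Matrix.cons_val_zero, Matrix.cons_val_one]; omega

/-- Index `< 18` of a point of the pair carrier: tops first, bottoms shifted by `9`. [this work] -/
def widx (u : W2) : ℕ := pidx u.2 + if u.1 then 0 else 9

/-- Indices are `< 18`. [this work] -/
theorem widx_lt (u : W2) : widx u < 18 := by
  have h := pidx_lt u.2; unfold widx; split_ifs <;> omega

/-- Top and bottom copies of a point, on indices. [this work] -/
theorem widx_mk (ε : Bool) (q : P2) : widx (ε, q) = if ε then pidx q else pidx q + 9 := by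
  unfold widx; cases ε <;> simp

/-- `widx` is injective. [this work] -/
theorem widx_injective : Function.Injective widx := by
  rintro ⟨ε, q⟩ ⟨ε', q'⟩ h
  have hq := pidx_lt q; have hq' := pidx_lt q'
  rw [widx_mk, widx_mk] at h
  cases ε <;> cases ε' <;> simp only [if_true, if_false, Bool.false_eq_true] at h
  · rw [pidx_injective (show pidx q = pidx q' by omega)]
  · omega
  · omega
  · rw [pidx_injective h]

/-- The point of the pair carrier with a given index `< 18`. [this work] -/
def wpt (n : ℕ) : W2 := (decide (n < 9), pnt (n % 9))

/-- `wpt ∘ widx = id`. [this work] -/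
theorem wpt_widx (u : W2) : wpt (widx u) = u := by
  obtain ⟨ε, q⟩ := u
  have hq := pidx_lt q
  rw [widx_mk]
  unfold wpt
  cases ε
  · simp only [Bool.false_eq_true, if_false]
    rw [show (pidx q + 9) % 9 = pidx q by omega, pnt_pidx]
    simp only [Prod.mk.injEq, decide_eq_false_iff_not, not_lt, and_true]; omega
  · simp only [if_true, Nat.mod_eq_of_lt hq, pnt_pidx, hq, decide_true]

/-- `widx ∘ wpt = id` below `18`. [this work] -/
theorem widx_wpt {n : ℕ} (hn : n < 18) : widx (wpt n) = n := by
  unfold wpt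
  rw [widx_mk]
  by_cases h9 : n < 9
  · simp only [h9, decide_true, if_true, Nat.mod_eq_of_lt h9, pidx_pnt h9]
  · rw [show n % 9 = n - 9 by omega]
    simp only [h9, decide_false, Bool.false_eq_true, if_false, pidx_pnt (show n - 9 < 9 by omega)]; omega

/-- Reindexing a sum over the `18` indices by the points of the pair carrier. [this work] -/
theorem sum_range18_eq_sum_univ (g : ℕ → ℤ) : ∑ n ∈ Finset.range 18, g n = ∑ u : W2, g (widx u) :=
  (Finset.sum_nbij' (fun u => widx u) (fun n => wpt n) (fun u _ => Finset.mem_range.2 (widx_lt u)) (fun _ _ => mem_univ _)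
    (fun u _ => wpt_widx u) (fun _ hn => widx_wpt (Finset.mem_range.1 hn)) (fun _ _ => rfl)).symm

/-! ### A pair of sets as one set of the pair carrier; the lifted kernel -/

/-- The pair `(T, B)` as ONE finset of `Bool × [3]²`: `{⊤} × T ∪ {⊥} × B`. [this work] -/
def pairSet (T B : Finset P2) : Finset W2 := univ.filter fun u => if u.1 then u.2 ∈ T else u.2 ∈ B

/-- Top points of `pairSet T B` are the points of `T`. [this work] -/
theorem ind_pairSet_true (T B : Finset P2) (q : P2) : ind (pairSet T B) (true, q) = ind T q := by
  unfold ind pairSet; simp only [mem_filter, mem_univ, true_and, if_true]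

/-- Bottom points of `pairSet T B` are the points of `B`. [this work] -/
theorem ind_pairSet_false (T B : Finset P2) (q : P2) : ind (pairSet T B) (false, q) = ind B q := by
  unfold ind pairSet; simp only [mem_filter, mem_univ, true_and, Bool.false_eq_true, if_false]

/-- **The lifted kernel**: the polarised kernel `tker` written with ONE set per slot (a finset of `Bool × [3]²`), every term a product of
one indicator per slot in slot order. [this work] -/
def tkerW (S₀ S₁ S₂ : Finset W2) (x y z : P2) : ℤ :=
  2 * (ind S₀ (false, x) * ind S₁ (false, x) * ind S₂ (false, x))
    + (ind S₀ (true, x) * ind S₁ (true, y) * ind S₂ (true, y) + ind S₀ (true, y) * ind S₁ (true, x) * ind S₂ (true, y)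
        + ind S₀ (true, y) * ind S₁ (true, y) * ind S₂ (true, x))
    - (ind S₀ (false, x) * ind S₁ (true, y) * ind S₂ (true, y) + ind S₀ (true, y) * ind S₁ (false, x) * ind S₂ (true, y)
        + ind S₀ (true, y) * ind S₁ (true, y) * ind S₂ (false, x))
    - (ind S₀ (true, x) * ind S₁ (false, y) * ind S₂ (false, y) + ind S₀ (false, y) * ind S₁ (true, x) * ind S₂ (false, y)
        + ind S₀ (false, y) * ind S₁ (false, y) * ind S₂ (true, x))
    - 2 * (ind S₀ (true, x) * ind S₁ (true, y) * ind S₂ (true, z))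
    + (ind S₀ (false, x) * ind S₁ (true, y) * ind S₂ (true, z) + ind S₀ (true, x) * ind S₁ (false, y) * ind S₂ (true, z)
        + ind S₀ (true, x) * ind S₁ (true, y) * ind S₂ (false, z))

/-- **`tker` is the lifted kernel of the three pair-sets.** [this work] -/
theorem tker_eq_tkerW (T B : Fin 3 → Finset P2) (x y z : P2) :
    tker T B x y z = tkerW (pairSet (T 0) (B 0)) (pairSet (T 1) (B 1)) (pairSet (T 2) (B 2)) x y z := by
  unfold tker tkerW
  simp only [ind_pairSet_true, ind_pairSet_false]
  ring

/-- Product of three indicator sums, expanded. [this work] -/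
theorem ind_mul3_eq_sum_W (S₀ S₁ S₂ : Finset W2) (s t u : W2) :
    ind S₀ s * ind S₁ t * ind S₂ u = ∑ a ∈ S₀, ∑ b ∈ S₁, ∑ c ∈ S₂, ind {a} s * ind {b} t * ind {c} u := by
  rw [SahiGrid3.ind_eq_sum_single S₀ s, SahiGrid3.ind_eq_sum_single S₁ t, SahiGrid3.ind_eq_sum_single S₂ u,
    Finset.sum_mul_sum, Finset.sum_mul]
  refine Finset.sum_congr rfl fun a _ => ?_
  rw [Finset.sum_mul]
  refine Finset.sum_congr rfl fun b _ => ?_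
  rw [Finset.mul_sum]

/-- **The lifted kernel is trilinear** in the three indicator functions. [this work] -/
theorem tkerW_eq_sum_single (S₀ S₁ S₂ : Finset W2) (x y z : P2) :
    tkerW S₀ S₁ S₂ x y z = ∑ a ∈ S₀, ∑ b ∈ S₁, ∑ c ∈ S₂, tkerW {a} {b} {c} x y z := by
  unfold tkerW
  simp only [ind_mul3_eq_sum_W S₀ S₁ S₂, Finset.mul_sum, ← Finset.sum_sub_distrib, ← Finset.sum_add_distrib]

/-- The coefficient of the trilinear form: the lifted kernel of three singletons summed over the `36` patterns. [this work] -/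
noncomputable def sT1 (a b c : W2) : ℤ :=
  ∑ π : Fin 2 → Equiv.Perm (Fin 3), tkerW {a} {b} {c} (col π 0) (col π 1) (col π 2)

/-- **Trilinear expansion of the tangent pattern functional**:
`sStarT T B = Σ_{a ∈ S_0} Σ_{b ∈ S_1} Σ_{c ∈ S_2} sT1 a b c`, `S_i = pairSet (T i) (B i)`. [this work] -/
theorem sStarT_eq_sum_single (T B : Fin 3 → Finset P2) :
    sStarT T B = ∑ a ∈ pairSet (T 0) (B 0), ∑ b ∈ pairSet (T 1) (B 1), ∑ c ∈ pairSet (T 2) (B 2), sT1 a b c := by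
  unfold sStarT sT1
  simp_rw [tker_eq_tkerW T B, tkerW_eq_sum_single (pairSet (T 0) (B 0)) (pairSet (T 1) (B 1)) (pairSet (T 2) (B 2))]
  rw [Finset.sum_comm]
  refine Finset.sum_congr rfl fun a _ => ?_
  rw [Finset.sum_comm]
  refine Finset.sum_congr rfl fun b _ => ?_
  rw [Finset.sum_comm]

/-! ### The coefficient tensor on indices -/

/-- Indicator of a singleton of the pair carrier, on indices. [this work] -/
theorem ind_single_eq_widx (a t : W2) : ind {a} t = if widx t = widx a then 1 else 0 := by
  unfold ind
  by_cases h : t = a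
  · subst h; simp
  · have h1 : t ∉ ({a} : Finset W2) := by rwa [Finset.mem_singleton]
    have h2 : widx t ≠ widx a := fun e => h (widx_injective e)
    simp [h1, h2]

/-- The `c`-th point of the pattern `(σ, τ) ∈ S₃²`: `(σ c, τ c)`. [this work] -/
def col2 (σ τ : Equiv.Perm (Fin 3)) (c : Fin 3) : P2 := ![σ c, τ c]

/-- `col` of the pattern `![σ, τ]` is `col2 σ τ`. [this work] -/
theorem col_finTwo (σ τ : Equiv.Perm (Fin 3)) (c : Fin 3) :
    col ((finTwoArrowEquiv (Equiv.Perm (Fin 3))).symm (σ, τ)) c = col2 σ τ c := by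
  funext a
  unfold col col2
  simp only [finTwoArrowEquiv_symm_apply]
  fin_cases a <;> rfl

/-- Sums over the patterns `S₃²` as iterated list sums over `permList`. [this work] -/
theorem sum_pattern_eq (f : (Fin 2 → Equiv.Perm (Fin 3)) → ℤ) :
    ∑ π, f π = (permList.map fun σ => (permList.map fun τ => f ((finTwoArrowEquiv _).symm (σ, τ))).sum).sum := by
  rw [← (finTwoArrowEquiv (Equiv.Perm (Fin 3))).symm.sum_comp, Fintype.sum_prod_type, sum_perm_eq_permList]
  apply congrArg List.sum; apply List.map_congr_left; intro σ _
  rw [sum_perm_eq_permList]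

/-- The `36` patterns of `[3]²` as index triples `(pidx x, pidx y, pidx z)`. [this work] -/
def pat36 : List (ℕ × ℕ × ℕ) :=
  permList.flatMap fun σ => permList.map fun τ => (pidx (col2 σ τ 0), pidx (col2 σ τ 1), pidx (col2 σ τ 2))

/-- The lifted kernel of three singletons `{a}, {b}, {c}` (given by indices `< 18`) at a pattern given by point indices:
`eT i n = [n = i]` (top copy of the point with index `n`), `eB i n = [n + 9 = i]` (bottom copy). [this work] -/
def kI (a b c : ℕ) (p : ℕ × ℕ × ℕ) : ℤ :=
  let eT := fun (i n : ℕ) => (if n = i then (1 : ℤ) else 0)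
  let eB := fun (i n : ℕ) => (if n + 9 = i then (1 : ℤ) else 0)
  let x := p.1; let y := p.2.1; let z := p.2.2
  2 * (eB a x * eB b x * eB c x)
    + (eT a x * eT b y * eT c y + eT a y * eT b x * eT c y + eT a y * eT b y * eT c x)
    - (eB a x * eT b y * eT c y + eT a y * eB b x * eT c y + eT a y * eT b y * eB c x)
    - (eT a x * eB b y * eB c y + eB a y * eT b x * eB c y + eB a y * eB b y * eT c x)
    - 2 * (eT a x * eT b y * eT c z)
    + (eB a x * eT b y * eT c z + eT a x * eB b y * eT c z + eT a x * eT b y * eB c z)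

/-- **`CI`**: the coefficient `sT1` computed on indices. [this work] -/
def CI (a b c : ℕ) : ℤ := (pat36.map (kI a b c)).sum

/-- **`CI` is `sT1` on indices.** [this work] -/
theorem CI_widx (a b c : W2) : CI (widx a) (widx b) (widx c) = sT1 a b c := by
  unfold CI pat36 sT1
  rw [sum_pattern_eq, sum_map_flatMap]
  apply congrArg List.sum; apply List.map_congr_left; intro σ _
  rw [List.map_map]
  apply congrArg List.sum; apply List.map_congr_left; intro τ _
  show kI (widx a) (widx b) (widx c) (pidx (col2 σ τ 0), pidx (col2 σ τ 1), pidx (col2 σ τ 2)) = _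
  rw [col_finTwo, col_finTwo, col_finTwo]
  have wT : ∀ q : P2, widx (true, q) = pidx q := fun q => by unfold widx; simp
  have wB : ∀ q : P2, widx (false, q) = pidx q + 9 := fun q => by unfold widx; simp
  have hT : ∀ (u : W2) (q : P2), (if pidx q = widx u then (1 : ℤ) else 0) = ind {u} (true, q) := by
    intro u q; rw [ind_single_eq_widx, wT]
  have hB : ∀ (u : W2) (q : P2), (if pidx q + 9 = widx u then (1 : ℤ) else 0) = ind {u} (false, q) := by
    intro u q; rw [ind_single_eq_widx, wB]
  unfold kI tkerW
  simp only [hT, hB]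

/-! ### The up-sets of the square: monotone threshold vectors -/

/-- Threshold of a vector at column `a`: entry `a`. [this work] -/
def thr2 (v : List ℕ) (a : Fin 3) : ℕ := v.getD a 0

/-- Boolean monotonicity test of a threshold vector. [this work] -/
def isMono2 (v : List ℕ) : Bool := decide (∀ a a' : Fin 3, a ≤ a' → thr2 v a ≤ thr2 v a')

/-- The monotone threshold vectors of length `3` over `{0,…,3}` (the `20` up-sets of `[3]²`). [this work] -/
def upVecs2 : List (List ℕ) := (vecs 3).filter isMono2

/-- The up-set of the square with threshold vector `v`: `{q | 3 − thr2 v (q 0) ≤ q 1}`. [this work] -/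
def U2 (v : List ℕ) : Finset P2 := univ.filter fun q => 3 - thr2 v (q 0) ≤ (q 1 : ℕ)

/-- Pointwise comparison of threshold vectors (Boolean). [this work] -/
def leV (w v : List ℕ) : Bool := decide (∀ a : Fin 3, thr2 w a ≤ thr2 v a)

/-- A point of the square in vector notation. [this work] -/
theorem vec2_eq (q : P2) : ![q 0, q 1] = q := by
  funext i; fin_cases i <;> rfl

/-- The fibre of a finset of the square over the column `a`. [this work] -/
def fib2 (A : Finset P2) (a : Fin 3) : Finset (Fin 3) := univ.filter fun c => (![a, c] : P2) ∈ A

/-- The threshold vector of a finset of the square: fibre cardinalities. [this work] -/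
def vecOf2 (A : Finset P2) : List ℕ := List.ofFn fun k : Fin 3 => (fib2 A k).card

/-- `thr2 (vecOf2 A) a` is the fibre cardinality. [this work] -/
theorem thr2_vecOf2 (A : Finset P2) (a : Fin 3) : thr2 (vecOf2 A) a = (fib2 A a).card := by
  have hlen : (a : ℕ) < (vecOf2 A).length := by unfold vecOf2; rw [List.length_ofFn]; exact a.isLt
  unfold thr2
  rw [List.getD_eq_getElem?_getD, List.getElem?_eq_getElem hlen, Option.getD_some]
  unfold vecOf2
  rw [List.getElem_ofFn]

/-- **Completeness, membership half**: the threshold vector of an up-set is one of the `20`. [this work] -/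
theorem vecOf2_mem_upVecs2 {A : Finset P2} (hA : IsUpperSet (A : Set P2)) : vecOf2 A ∈ upVecs2 := by
  unfold upVecs2
  rw [List.mem_filter]
  refine ⟨?_, ?_⟩
  · have hlen : (vecOf2 A).length = 3 := by unfold vecOf2; rw [List.length_ofFn]
    rw [← hlen]
    refine mem_vecs _ fun x hx => ?_
    unfold vecOf2 at hx
    rw [List.mem_ofFn] at hx
    obtain ⟨k, rfl⟩ := hx
    exact (card_le_univ _).trans (by rw [Fintype.card_fin])
  · unfold isMono2
    rw [decide_eq_true_eq]
    intro a a' ha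
    rw [thr2_vecOf2, thr2_vecOf2]
    refine card_le_card fun c hc => ?_
    unfold fib2 at hc ⊢
    rw [mem_filter] at hc ⊢
    refine ⟨mem_univ _, hA (show (![a, c] : P2) ≤ ![a', c] from ?_) hc.2⟩
    intro i; fin_cases i
    · exact ha
    · exact le_rfl

/-- **Completeness, equality half**: an up-set of the square IS the staircase of its threshold vector. [this work] -/
theorem U2_vecOf2 {A : Finset P2} (hA : IsUpperSet (A : Set P2)) : U2 (vecOf2 A) = A := by
  ext q
  unfold U2
  rw [mem_filter, thr2_vecOf2]
  have hup : ∀ c c' : Fin 3, c ≤ c' → c ∈ fib2 A (q 0) → c' ∈ fib2 A (q 0) := by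
    intro c c' hcc' hc
    unfold fib2 at hc ⊢
    rw [mem_filter] at hc ⊢
    refine ⟨mem_univ _, hA (show (![q 0, c] : P2) ≤ ![q 0, c'] from ?_) hc.2⟩
    intro i; fin_cases i
    · exact le_rfl
    · exact hcc'
  have key := mem_iff_card_of_upper (fib2 A (q 0)) hup (q 1)
  have hmem : q 1 ∈ fib2 A (q 0) ↔ q ∈ A := by
    unfold fib2; rw [mem_filter, vec2_eq]; exact ⟨fun h => h.2, fun h => ⟨mem_univ _, h⟩⟩
  rw [← hmem, key]
  exact ⟨fun h => h.2, fun h => ⟨mem_univ _, h⟩⟩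

/-- **Inclusion is pointwise comparison of threshold vectors.** [this work] -/
theorem leV_vecOf2 {B T : Finset P2} (hBT : B ⊆ T) : leV (vecOf2 B) (vecOf2 T) = true := by
  unfold leV
  rw [decide_eq_true_eq]
  intro a
  rw [thr2_vecOf2, thr2_vecOf2]
  refine card_le_card fun c hc => ?_
  unfold fib2 at hc ⊢
  rw [mem_filter] at hc ⊢
  exact ⟨mem_univ _, hBT hc.2⟩

end Summit.CriticalPhenomena.PercolationContinuityZ3.Theorems.SahiTangent
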